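import Literature.Analysis.FluidPDE.DivCurlAnnihilator
import Literature.Analysis.FluidPDE.BiotSavartCurlPair
import Literature.Analysis.FluidPDE.NewtonPotentialHolder
import HarnessLib

/-!
# The weak `div`–`curl` Liouville theorem with an `|x|⁻¹` envelope — crux
  stmt-NavierStokesRegularity-1404 (`QuantisedSymmetry.PolyhedralDssProfileExists`), line
  polyhedral_cell, stub stub_weakDivCurlLiouville (N30)

Registered stub `stub_weakDivCurlLiouville` (`--supports stmt-NavierStokesRegularity-1404`): a
locally integrable field `W : ℝ³ → ℝ³` which is weakly divergence free, weakly curl free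
(`∫ ⟪W, curl ψ⟫ = 0` for every smooth compactly supported `ψ`) and satisfies `‖W x‖ ≤ C/‖x‖` for
a.e. `x` vanishes a.e.

Proof sketch (Lemarié-Rieusset 2016, proof of Thm. 4.4, pp. 56–57: "solenoidal and irrotational
⇒ harmonic ⇒ `0`", in the tree's `L^p + L^q` form). The envelope `C/|x|` (`C ≥ 0` w.l.o.g.) puts
the near field `1_{|x|<1} W` in `L²(ℝ³)` (`|x|⁻² ∈ L¹(B₁)`,
`NewtonPotentialHolder.integrableOn_ball_norm_rpow_neg`) and the far field `1_{|x|≥1} W` in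
`L⁴(ℝ³)` (`|x|⁻⁴ ∈ L¹(ℝ³ ∖ B₁)`, `NewtonPotentialHolder.integrableOn_compl_ball_norm_rpow_neg`), so
`W ∈ L² + L⁴`. The curl-type test fields `(∂ₐg) c − (∂_c g) a` of the tree's annihilator lemma
are genuine curls, `= curl (g · (c × a))` (`curlPair_eq_curl_smul_cross`), and `g · (c × a)` is a
vector test function, so weak irrotationality in the sense of the signature implies annihilation
of all curl-type fields; the `div`–`curl` annihilator lemma in `L^p + L^q`
(`IsWeaklyDivFree.ae_eq_zero_of_add_memLp_of_forall_integral_inner_curlPair_eq_zero`,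
`DivCurlAnnihilator.lean`: mollify, Weyl–Liouville for `L^p + L^q` harmonic functions, Lebesgue
differentiation) gives `W = 0` a.e.
-/

noncomputable section

-- the summit namespace `…NavierStokesRegularity.NavierStokesRegularity…` is the tree convention (D-0017)
set_option linter.dupNamespace false

namespace Summit.NavierStokesRegularity.NavierStokesRegularity.Theorems.PolyhedralDssProfileExists.PolyhedralCell

open MeasureTheory Set Function Filter Topology Metric
open Literature.Analysis Literature.Analysis.FluidPDE
open scoped InnerProductSpace RealInnerProductSpace ENNReal

/-! ### Curl-type test fields are curls of test fields -/

/-- A scalar test function times a constant vector is a (vector) test function. [folklore] -/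
theorem weakDivCurl_isTestFunctionOn_smul_const {g : EuclideanSpace ℝ (Fin 3) → ℝ}
    (hg : FunctionSpaces.IsTestFunctionOn
      (⊤ : TopologicalSpace.Opens (EuclideanSpace ℝ (Fin 3))) g)
    (v : EuclideanSpace ℝ (Fin 3)) :
    FunctionSpaces.IsTestFunctionOn
      (⊤ : TopologicalSpace.Opens (EuclideanSpace ℝ (Fin 3))) fun y => g y • v where
  contDiff := hg.contDiff.smul contDiff_const
  hasCompactSupport := hg.hasCompactSupport.smul_right (f' := fun _ => v)
  tsupport_subset := by simp

/-- **Weakly curl-free fields annihilate the curl-type test fields.** If `∫ ⟪W, curl ψ⟫ = 0` for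
every vector test function `ψ`, then `∫ ⟪W, (∂ₐg) c − (∂_c g) a⟫ = 0` for every scalar test
function `g` and all `a, c`: indeed `(∂ₐg) c − (∂_c g) a = curl (g · (c × a))`
(`curlPair_eq_curl_smul_cross`). [folklore] -/
theorem weakDivCurl_integral_inner_curlPair_eq_zero
    {W : EuclideanSpace ℝ (Fin 3) → EuclideanSpace ℝ (Fin 3)}
    (hcurl : ∀ ψ : EuclideanSpace ℝ (Fin 3) → EuclideanSpace ℝ (Fin 3),
      FunctionSpaces.IsTestFunctionOn
        (⊤ : TopologicalSpace.Opens (EuclideanSpace ℝ (Fin 3))) ψ →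
      ∫ x, ⟪W x, curl ψ x⟫_ℝ = 0) :
    ∀ g : EuclideanSpace ℝ (Fin 3) → ℝ,
      FunctionSpaces.IsTestFunctionOn (⊤ : TopologicalSpace.Opens (EuclideanSpace ℝ (Fin 3))) g →
      ∀ a c : EuclideanSpace ℝ (Fin 3),
        ∫ x, ⟪W x, fderiv ℝ g x a • c - fderiv ℝ g x c • a⟫_ℝ = 0 := by
  intro g hg a c
  have hd : Differentiable ℝ g := hg.contDiff.differentiable (by simp)
  calc ∫ x, ⟪W x, fderiv ℝ g x a • c - fderiv ℝ g x c • a⟫_ℝ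
      = ∫ x, ⟪W x, curl (fun y => g y • cross c a) x⟫_ℝ := by
        refine integral_congr_ae (ae_of_all _ fun x => ?_)
        dsimp only
        rw [curlPair_eq_curl_smul_cross (hd x)]
    _ = 0 := hcurl _ (weakDivCurl_isTestFunctionOn_smul_const hg (cross c a))

/-! ### The envelope `C/|x|` puts `W` in `L² + L⁴(ℝ³)` -/

/-- **Near field in `L²`.** If `‖W x‖ ≤ C/‖x‖` a.e. (`C ≥ 0`) and `W` is a.e. strongly measurable,
then `1_{B₁} W ∈ L²(ℝ³)`: `‖1_{B₁} W‖² ≤ 1_{B₁} C² |x|⁻²` and `|x|⁻² ∈ L¹(B₁)` in dimension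
three. [folklore] -/
theorem weakDivCurl_memLp_two_indicator_ball
    {W : EuclideanSpace ℝ (Fin 3) → EuclideanSpace ℝ (Fin 3)} {C : ℝ}
    (hWm : AEStronglyMeasurable W volume) (hbound : ∀ᵐ x ∂volume, ‖W x‖ ≤ C / ‖x‖) :
    MemLp ((ball (0 : EuclideanSpace ℝ (Fin 3)) 1).indicator W) 2 volume := by
  have hm : AEStronglyMeasurable ((ball (0 : EuclideanSpace ℝ (Fin 3)) 1).indicator W) volume :=
    hWm.indicator measurableSet_ball
  rw [memLp_two_iff_integrable_sq_norm hm]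
  have hdom : Integrable ((ball (0 : EuclideanSpace ℝ (Fin 3)) 1).indicator
      fun x => C ^ 2 * ‖x‖ ^ (-(2 : ℝ))) volume := by
    rw [integrable_indicator_iff measurableSet_ball]
    exact (NewtonPotentialHolder.integrableOn_ball_norm_rpow_neg (by norm_num) 1).const_mul (C ^ 2)
  refine hdom.mono' ((continuous_pow 2).comp_aestronglyMeasurable hm.norm) ?_
  filter_upwards [hbound] with x hx
  rw [norm_pow, norm_norm]
  by_cases hxB : x ∈ ball (0 : EuclideanSpace ℝ (Fin 3)) 1
  · rw [indicator_of_mem hxB, indicator_of_mem hxB]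
    calc ‖W x‖ ^ 2 ≤ (C / ‖x‖) ^ 2 := pow_le_pow_left₀ (norm_nonneg _) hx 2
      _ = C ^ 2 * ‖x‖ ^ (-(2 : ℝ)) := by
        rw [div_pow, Real.rpow_neg (norm_nonneg _), Real.rpow_two, div_eq_mul_inv]
  · rw [indicator_of_notMem hxB, indicator_of_notMem hxB]
    simp

/-- **Far field in `L⁴`.** If `‖W x‖ ≤ C/‖x‖` a.e. with `C ≥ 0` and `W` is a.e. strongly
measurable, then `1_{ℝ³ ∖ B₁} W ∈ L⁴(ℝ³)`: `‖1_{ℝ³∖B₁} W‖⁴ ≤ 1_{ℝ³∖B₁} C⁴ |x|⁻⁴` and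
`|x|⁻⁴ ∈ L¹(ℝ³ ∖ B₁)`. [folklore] -/
theorem weakDivCurl_memLp_four_indicator_compl_ball
    {W : EuclideanSpace ℝ (Fin 3) → EuclideanSpace ℝ (Fin 3)} {C : ℝ} (hC : 0 ≤ C)
    (hWm : AEStronglyMeasurable W volume) (hbound : ∀ᵐ x ∂volume, ‖W x‖ ≤ C / ‖x‖) :
    MemLp ((ball (0 : EuclideanSpace ℝ (Fin 3)) 1)ᶜ.indicator W) 4 volume := by
  have hm : AEStronglyMeasurable ((ball (0 : EuclideanSpace ℝ (Fin 3)) 1)ᶜ.indicator W) volume :=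
    hWm.indicator measurableSet_ball.compl
  rw [← integrable_norm_rpow_iff hm (by norm_num) ENNReal.ofNat_ne_top]
  have h4 : (4 : ℝ≥0∞).toReal = 4 := by norm_num
  simp only [h4]
  have hdom : Integrable ((ball (0 : EuclideanSpace ℝ (Fin 3)) 1)ᶜ.indicator
      fun x => C ^ (4 : ℝ) * ‖x‖ ^ (-(4 : ℝ))) volume := by
    rw [integrable_indicator_iff measurableSet_ball.compl]
    exact (NewtonPotentialHolder.integrableOn_compl_ball_norm_rpow_neg (by norm_num) one_pos).const_mul
      (C ^ (4 : ℝ))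
  refine hdom.mono' (hm.norm.aemeasurable.pow_const _).aestronglyMeasurable ?_
  filter_upwards [hbound] with x hx
  rw [Real.norm_eq_abs, abs_of_nonneg (Real.rpow_nonneg (norm_nonneg _) _)]
  by_cases hxB : x ∈ (ball (0 : EuclideanSpace ℝ (Fin 3)) 1)ᶜ
  · rw [indicator_of_mem hxB, indicator_of_mem hxB]
    calc ‖W x‖ ^ (4 : ℝ) ≤ (C / ‖x‖) ^ (4 : ℝ) := Real.rpow_le_rpow (norm_nonneg _) hx (by norm_num)
      _ = C ^ (4 : ℝ) * ‖x‖ ^ (-(4 : ℝ)) := by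
        rw [Real.div_rpow hC (norm_nonneg _), Real.rpow_neg (norm_nonneg _), div_eq_mul_inv]
  · rw [indicator_of_notMem hxB, indicator_of_notMem hxB]
    simp [Real.zero_rpow (by norm_num : (4 : ℝ) ≠ 0)]

/-! ### The stub -/

/-- **Stub N30: the weak `div`–`curl` Liouville theorem with an `|x|⁻¹` envelope.** A locally
integrable field `W` on `ℝ³` which is weakly divergence free AND weakly curl free
(`∫ ⟪W, curl ψ⟫ = 0` for every smooth compactly supported `ψ`) and satisfies `‖W x‖ ≤ C/‖x‖` for
a.e. `x` vanishes a.e. Proof: `W ∈ L² + L⁴(ℝ³)` (near/far splitting of the envelope,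
`weakDivCurl_memLp_two_indicator_ball`, `weakDivCurl_memLp_four_indicator_compl_ball`), weak
irrotationality gives annihilation of the curl-type fields `(∂ₐg) c − (∂_c g) a = curl (g (c × a))`
(`weakDivCurl_integral_inner_curlPair_eq_zero`), and the tree's `div`–`curl` annihilator lemma in
`L^p + L^q` (`IsWeaklyDivFree.ae_eq_zero_of_add_memLp_of_forall_integral_inner_curlPair_eq_zero`:
solenoidal and irrotational ⇒ weakly harmonic components ⇒ `0` by Weyl–Liouville) concludes. [cite: LemarieRieusset2016, proof of Thm. 4.4 (uniqueness part) pp. 56–57] -/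
theorem stub_weakDivCurlLiouville :
    ∀ (W : EuclideanSpace ℝ (Fin 3) → EuclideanSpace ℝ (Fin 3)) (C : ℝ),
      LocallyIntegrable W volume → IsWeaklyDivFree W →
      (∀ ψ : EuclideanSpace ℝ (Fin 3) → EuclideanSpace ℝ (Fin 3),
        Literature.Analysis.FunctionSpaces.IsTestFunctionOn
          (⊤ : TopologicalSpace.Opens (EuclideanSpace ℝ (Fin 3))) ψ →
        ∫ x, ⟪W x, curl ψ x⟫_ℝ = 0) →
      (∀ᵐ x ∂volume, ‖W x‖ ≤ C / ‖x‖) →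
      W =ᵐ[volume] 0 := by
  intro W C hW hdiv hcurl hbound
  -- w.l.o.g. the constant is nonnegative
  have hC' : 0 ≤ max C 0 := le_max_right _ _
  have hbound' : ∀ᵐ x ∂volume, ‖W x‖ ≤ max C 0 / ‖x‖ :=
    hbound.mono fun x hx => hx.trans (div_le_div_of_nonneg_right (le_max_left _ _) (norm_nonneg _))
  have hWm : AEStronglyMeasurable W volume := hW.aestronglyMeasurable
  -- near/far splitting `W = 1_{B₁} W + 1_{ℝ³ ∖ B₁} W ∈ L² + L⁴`
  have hsplit : (ball (0 : EuclideanSpace ℝ (Fin 3)) 1).indicator W +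
      (ball (0 : EuclideanSpace ℝ (Fin 3)) 1)ᶜ.indicator W = W :=
    Set.indicator_self_add_compl _ _
  have h := IsWeaklyDivFree.ae_eq_zero_of_add_memLp_of_forall_integral_inner_curlPair_eq_zero
    (p := 2) (q := 4) ENNReal.one_lt_two ENNReal.ofNat_lt_top (by norm_num) ENNReal.ofNat_lt_top
    (weakDivCurl_memLp_two_indicator_ball hWm hbound')
    (weakDivCurl_memLp_four_indicator_compl_ball hC' hWm hbound')
    (by rw [hsplit]; exact hdiv)
    (by rw [hsplit]; exact weakDivCurl_integral_inner_curlPair_eq_zero hcurl)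
  rwa [hsplit] at h

end Summit.NavierStokesRegularity.NavierStokesRegularity.Theorems.PolyhedralDssProfileExists.PolyhedralCell

end
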